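import Mathlib
import Summits.KontsevichZagierPeriods.KontsevichZagierPeriods.Theorems.SoloInformedStuffleReps
import Summits.KontsevichZagierPeriods.KontsevichZagierPeriods.Theorems.SoloInformedSumStar
import HarnessLib
import HarnessLib.Audit

/-!
# SoloInformed — cube representations of multiple zeta classes at all depths

Solo programme `solo-KontsevichZagierPeriods-informed`, session s47 (PROGRAMME XLVI, file 1).

For an admissible index `u = (u₁,…,u_k)` of weight `m+1` with binary word
`ε = 0^{u₁-1}1 ⋯ 0^{u_k-1}1` (`ε_m = 1`), the prefix-product chart
`κ(x)_j = x₀ ⋯ x_j` of the open cube onto the open ordered simplex (THEOREMS XXIII–XXIV,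
`SoloInformedNashSimplex`) pulls the simplex form `∏ₖ ω_{εₖ}(tₖ)` back to

  `F_ε(x) = (∏_{i<m, εᵢ=1} Pᵢ/(1 − Pᵢ)) · 1/(1 − P_m)`,   `P_j = x₀ ⋯ x_j`

(`soloInformedCubeWf`, `soloInformed_word_kappa`; the Jacobian `∏_{i<m} Pᵢ` of `κ` cancels
every `dt/t` and turns every interior `dt/(1−t)` into `P/(1−P)`).  This gives the
**cube representation** `CubeW u = [(0,1)^{m+1}, F_ε]` of `Z(u)` at every depth
(`soloInformedCubeW`; integrability is transported from the simplex representation along `κ`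
by the change-of-variables theorem, `soloInformed_integrableOn_image_polyMap_iff`), and

  `⟦CubeW u⟧ = mzvClass u`  in `𝒫 = KZ.FormalPeriodRing`   (`soloInformed_cubeW_class`)

by one application of rule (2).  In cube coordinates `F_ε` is the closed form of the nested
harmonic sum `Σ_{n₁>⋯>n_k>0} ∏ B_r^{n_r}`-type generating function of the block products, which
is what makes Hoffman's harmonic (stuffle) product visible move by move (files 2–4 of
PROGRAMME XLVI).

References: Kontsevich–Zagier 2001 §1.2 (rule (2)); Zagier 1994 §9; Hoffman 1992 §2.
-/

noncomputable section

open MeasureTheory Set MvPolynomial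
open Literature.ModelTheory.ExponentialFields Literature.NumberTheory.Transcendental
open Literature.NumberTheory.Transcendental.KZ

namespace Summit.KontsevichZagierPeriods.KontsevichZagierPeriods.Theorems

/-! ## 1. The cube integrand of a word and its pull-back identity -/

section word

variable {m : ℕ}

/-- The cube integrand of a binary word `ε` on `Fin (m+1)` (read with `ε_m = 1`):
`F_ε(x) = (∏_{i<m, εᵢ} Pᵢ/(1 − Pᵢ)) · 1/(1 − P_m)`, `P_j` the prefix products. -/
def soloInformedCubeWf (ε : Fin (m + 1) → Bool) (x : Fin (m + 1) → ℝ) : ℝ :=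
  (∏ i : Fin m, if ε (Fin.castSucc i) then
      soloInformedPrefixProd x (Fin.castSucc i) / (1 - soloInformedPrefixProd x (Fin.castSucc i))
    else 1) *
    (1 / (1 - soloInformedPrefixProd x (Fin.last m)))

/-- **General word**: `(∏ₖ ω_{εₖ}(tₖ)) · ∏_{i<m} tᵢ = (∏_{i<m, εᵢ} tᵢ/(1 − tᵢ)) · 1/(1 − t_m)` when
`ε_m = 1` and no `tₖ` vanishes. -/
theorem soloInformed_word_mul (ε : Fin (m + 1) → Bool) (hε : ε (Fin.last m) = true)
    (t : Fin (m + 1) → ℝ) (ht : ∀ k, t k ≠ 0) :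
    (∏ k : Fin (m + 1), mzvForm (ε k) (t k)) * ∏ i : Fin m, t (Fin.castSucc i) =
      (∏ i : Fin m, if ε (Fin.castSucc i) then t (Fin.castSucc i) / (1 - t (Fin.castSucc i))
        else 1) * (1 / (1 - t (Fin.last m))) := by
  rw [Fin.prod_univ_castSucc, hε, mzvForm_true]
  have h1 : (∏ i : Fin m, mzvForm (ε (Fin.castSucc i)) (t (Fin.castSucc i))) *
      ∏ i : Fin m, t (Fin.castSucc i) =
      ∏ i : Fin m, if ε (Fin.castSucc i) then t (Fin.castSucc i) / (1 - t (Fin.castSucc i))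
        else 1 := by
    rw [← Finset.prod_mul_distrib]
    refine Finset.prod_congr rfl fun i _ => ?_
    cases ε (Fin.castSucc i)
    · simp [ht (Fin.castSucc i)]
    · simp only [mzvForm_true, if_true]
      ring
  calc (∏ i : Fin m, mzvForm (ε (Fin.castSucc i)) (t (Fin.castSucc i))) * (1 / (1 - t (Fin.last m))) *
        ∏ i : Fin m, t (Fin.castSucc i)
      = (∏ i : Fin m, mzvForm (ε (Fin.castSucc i)) (t (Fin.castSucc i))) *
          (∏ i : Fin m, t (Fin.castSucc i)) * (1 / (1 - t (Fin.last m))) := by ring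
    _ = _ := by rw [h1]

/-- `F_ε` as one quotient: numerator `∏_{εᵢ} Pᵢ`, denominator `(∏_{εᵢ} (1 − Pᵢ)) · (1 − P_m)`. -/
theorem soloInformed_cubeWf_eq_div (ε : Fin (m + 1) → Bool) (x : Fin (m + 1) → ℝ) :
    soloInformedCubeWf ε x =
      (∏ i : Fin m, if ε (Fin.castSucc i) then soloInformedPrefixProd x (Fin.castSucc i) else 1) /
        ((∏ i : Fin m, if ε (Fin.castSucc i) then 1 - soloInformedPrefixProd x (Fin.castSucc i)
            else 1) * (1 - soloInformedPrefixProd x (Fin.last m))) := by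
  rw [soloInformedCubeWf, div_mul_eq_div_mul_one_div, ← Finset.prod_div_distrib]
  congr 1
  refine Finset.prod_congr rfl fun i _ => ?_
  split_ifs <;> simp

variable {x : Fin (m + 1) → ℝ} (hx : x ∈ soloInformedOpenCube (m + 1))
include hx

/-- **Pull-back of a word along `κ`**: `F_ε(x) = (∏ₖ ω_{εₖ}(κ(x)ₖ)) · |det J_κ(x)|` on the open
cube, for every word with `ε_m = 1`. -/
theorem soloInformed_word_kappa (ε : Fin (m + 1) → Bool) (hε : ε (Fin.last m) = true) :
    soloInformedCubeWf ε x =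
      (∏ k : Fin (m + 1), mzvForm (ε k) (soloInformedKappaMap (m + 1) x k)) *
        |(soloInformedJacCLM (soloInformedMonoPoly (m + 1)) x).det| := by
  rw [soloInformed_abs_det_kappa hx]
  simp only [soloInformedKappa_apply]
  exact (soloInformed_word_mul ε hε (fun k => soloInformedPrefixProd x k)
    (fun k => (soloInformed_prefixProd_pos hx k).ne')).symm

/-- The denominator factors `1 − Pᵢ` (kept only where `εᵢ = 1`) have positive product. -/
theorem soloInformed_prod_ite_one_sub_prefix_pos (ε : Fin (m + 1) → Bool) :
    0 < ∏ i : Fin m, if ε (Fin.castSucc i) then 1 - soloInformedPrefixProd x (Fin.castSucc i)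
      else 1 :=
  Finset.prod_pos fun i _ => by
    split_ifs
    · exact soloInformed_one_sub_prefix_pos hx _
    · exact one_pos

/-- `F_ε > 0` on the open cube. -/
theorem soloInformed_cubeWf_pos (ε : Fin (m + 1) → Bool) : 0 < soloInformedCubeWf ε x := by
  refine mul_pos (Finset.prod_pos fun i _ => ?_)
    (one_div_pos.2 (soloInformed_one_sub_prefix_pos hx _))
  split_ifs
  · exact div_pos (soloInformed_prefixProd_pos hx _) (soloInformed_one_sub_prefix_pos hx _)
  · exact one_pos

end word

/-! ## 2. The word of an admissible index as a function on `Fin (m+1)` -/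

section wordFn

variable {m : ℕ}

/-- The binary word of `u`, read as a function on `Fin (m+1)`. -/
def soloInformedWordFn (u : List ℕ) (m : ℕ) : Fin (m + 1) → Bool :=
  fun k => (MZV.binaryWord u).getD k false

/-- Evaluation of the word function. -/
theorem soloInformedWordFn_apply (u : List ℕ) (k : Fin (m + 1)) :
    soloInformedWordFn u m k = (MZV.binaryWord u).getD k false := rfl

/-- An index of weight `m+1` is nonempty. -/
theorem soloInformed_ne_nil_of_weight {u : List ℕ} (hw : MZV.weight u = m + 1) : u ≠ [] := by
  rintro rfl
  simp [MZV.weight] at hw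

/-- **The last letter is `1`.** For an admissible index of weight `m+1` the word function is
`true` at `Fin.last m`. -/
theorem soloInformed_wordFn_last {u : List ℕ} (hu : MZV.IsAdmissible u) (hw : MZV.weight u = m + 1) :
    soloInformedWordFn u m (Fin.last m) = true := by
  obtain ⟨l, hl⟩ := MZV.exists_binaryWord_eq_append_true (soloInformed_ne_nil_of_weight hw)
  have hlen : (MZV.binaryWord u).length = m + 1 := by rw [hu.length_binaryWord, hw]
  have hl' : l.length = m := by
    rw [hl, List.length_append, List.length_singleton] at hlen
    omega
  rw [soloInformedWordFn_apply, hl, Fin.val_last, List.getD_eq_getElem _ _ (by simp [hl']),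
    List.getElem_append_right (by omega)]
  simp [hl']

end wordFn

/-! ## 3. The cube representation of an admissible index -/

section cubeW

variable {m : ℕ}

/-- The numerator polynomial `∏_{i<m, εᵢ} μᵢ` of `F_ε`. -/
def soloInformedCubeWNum (ε : Fin (m + 1) → Bool) : MvPolynomial (Fin (m + 1)) ℚ :=
  ∏ i : Fin m, if ε (Fin.castSucc i) then soloInformedMonoPoly (m + 1) (Fin.castSucc i) else 1

/-- The denominator polynomial `(∏_{i<m, εᵢ} (1 − μᵢ)) · (1 − μ_m)` of `F_ε`. -/
def soloInformedCubeWDen (ε : Fin (m + 1) → Bool) : MvPolynomial (Fin (m + 1)) ℚ :=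
  (∏ i : Fin m, if ε (Fin.castSucc i) then 1 - soloInformedMonoPoly (m + 1) (Fin.castSucc i) else 1) *
    (1 - soloInformedMonoPoly (m + 1) (Fin.last m))

/-- Evaluation of the numerator polynomial. -/
theorem soloInformed_aeval_cubeWNum (ε : Fin (m + 1) → Bool) (x : Fin (m + 1) → ℝ) :
    (aeval x (soloInformedCubeWNum ε) : ℝ) =
      ∏ i : Fin m, if ε (Fin.castSucc i) then soloInformedPrefixProd x (Fin.castSucc i) else 1 := by
  rw [soloInformedCubeWNum, map_prod]
  refine Finset.prod_congr rfl fun i _ => ?_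
  split_ifs <;> simp [soloInformed_aeval_monoPoly]

/-- Evaluation of the denominator polynomial. -/
theorem soloInformed_aeval_cubeWDen (ε : Fin (m + 1) → Bool) (x : Fin (m + 1) → ℝ) :
    (aeval x (soloInformedCubeWDen ε) : ℝ) =
      (∏ i : Fin m, if ε (Fin.castSucc i) then 1 - soloInformedPrefixProd x (Fin.castSucc i)
          else 1) * (1 - soloInformedPrefixProd x (Fin.last m)) := by
  rw [soloInformedCubeWDen, map_mul, map_prod]
  congr 1
  · refine Finset.prod_congr rfl fun i _ => ?_
    split_ifs <;> simp [soloInformed_aeval_monoPoly]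
  · simp [soloInformed_aeval_monoPoly]

/-- `F_ε` is `ℚ`-semialgebraic on the open cube (a quotient of rational polynomials off its poles). -/
theorem soloInformed_isSemialgebraicFunOn_cubeWf (ε : Fin (m + 1) → Bool) :
    IsSemialgebraicFunOn ℚ (soloInformedOpenCube (m + 1)) (soloInformedCubeWf ε) :=
  soloInformed_isSemialgebraicFunOn_quot (isSemialgebraic_soloInformedOpenCube _)
    (soloInformedCubeWNum ε) (soloInformedCubeWDen ε) _
    (fun x hx => by
      rw [soloInformed_aeval_cubeWDen]
      exact (mul_pos (soloInformed_prod_ite_one_sub_prefix_pos hx ε)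
        (soloInformed_one_sub_prefix_pos hx _)).ne')
    fun x _ => by
      rw [soloInformed_aeval_cubeWNum, soloInformed_aeval_cubeWDen, soloInformed_cubeWf_eq_div]

variable (u : List ℕ) (hu : MZV.IsAdmissible u) (hw : MZV.weight u = m + 1)
include hu hw

/-- **Integrability of `F_ε` on the cube, transported from the simplex along `κ`.** -/
theorem soloInformed_integrableOn_cubeWf :
    IntegrableOn (soloInformedCubeWf (soloInformedWordFn u m)) (soloInformedOpenCube (m + 1)) := by
  obtain ⟨r, hd, hi, -⟩ := soloInformed_exists_wordRep hu hw
  have hg : IntegrableOn r.integrand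
      (soloInformedPolyMap (soloInformedMonoPoly (m + 1)) '' soloInformedOpenCube (m + 1)) := by
    rw [show soloInformedPolyMap (soloInformedMonoPoly (m + 1)) = soloInformedKappaMap (m + 1)
      from rfl, soloInformed_image_kappa_eq, ← hd]
    exact r.integrableOn
  have h2 := (soloInformed_integrableOn_image_polyMap_iff (soloInformedMonoPoly (m + 1))
    (soloInformed_measurableSet_openCube _) (soloInformed_injOn_kappa (m + 1)) r.integrand).1 hg
  refine h2.congr_fun (fun x hx => ?_) (soloInformed_measurableSet_openCube _)
  dsimp only
  rw [hi, mul_comm]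
  exact (soloInformed_word_kappa hx _ (soloInformed_wordFn_last hu hw)).symm

/-- **The cube representation `CubeW u = [(0,1)^{m+1}, F_ε]`** of an admissible index `u` of weight
`m+1` (`ε` its binary word). -/
def soloInformedCubeW : IntegralRep (m + 1) where
  domain := soloInformedOpenCube (m + 1)
  integrand := soloInformedCubeWf (soloInformedWordFn u m)
  isSemialgebraic_domain := isSemialgebraic_soloInformedOpenCube _
  isSemialgebraicFunOn_integrand := soloInformed_isSemialgebraicFunOn_cubeWf _
  integrableOn := soloInformed_integrableOn_cubeWf u hu hw

/-- The domain of `CubeW u`. -/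
@[simp] theorem soloInformedCubeW_domain :
    (soloInformedCubeW u hu hw).domain = soloInformedOpenCube (m + 1) := rfl

/-- The integrand of `CubeW u`. -/
@[simp] theorem soloInformedCubeW_integrand :
    (soloInformedCubeW u hu hw).integrand = soloInformedCubeWf (soloInformedWordFn u m) := rfl

/-- **`⟦CubeW u⟧ = mzvClass u`** for every admissible index (rule (2) along `κ`). -/
theorem soloInformed_cubeW_class : toFormalPeriod (of (soloInformedCubeW u hu hw)) = mzvClass u := by
  obtain ⟨r, hd, hi, hcl⟩ := soloInformed_exists_wordRep hu hw
  rw [← hcl, toFormalPeriod_eq_iff]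
  refine soloInformed_of_sub_of_mem_relations_polyMapCLM (soloInformedMonoPoly (m + 1)) _ r
    (soloInformed_injOn_kappa (m + 1)) (by rw [hd]; exact (soloInformed_image_kappa_eq (m + 1)).symm)
    fun x hx => ?_
  rw [hi]
  exact soloInformed_word_kappa hx _ (soloInformed_wordFn_last hu hw)

end cubeW

/-! ## 4. Sanity: depth one and the value -/

section sanity

variable {m : ℕ}

/-- For `u = (m+1)` the word has no interior `1`: `F = 1/(1 − P_m)`, the `CubeZ` integrand. -/
theorem soloInformed_cubeWf_single (x : Fin (m + 1) → ℝ) :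
    soloInformedCubeWf (soloInformedWordFn [m + 1] m) x =
      1 / (1 - soloInformedPrefixProd x (Fin.last m)) := by
  rw [soloInformedCubeWf]
  have h : ∀ i : Fin m, soloInformedWordFn [m + 1] m (Fin.castSucc i) = false := fun i => by
    rw [soloInformedWordFn_apply, soloInformed_binaryWord_single_getD]
    simp only [Fin.val_castSucc, decide_eq_false_iff_not]
    have := i.2
    omega
  simp [h]

/-- The value of `CubeW u` is `ζ(u)`. -/
theorem soloInformed_cubeW_value (u : List ℕ) (hu : MZV.IsAdmissible u) (hw : MZV.weight u = m + 1) :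
    (soloInformedCubeW u hu hw).value = multipleZeta u := by
  rw [← evalP_toFormalPeriod_of, soloInformed_cubeW_class, evalP_mzvClass hu]

end sanity

end Summit.KontsevichZagierPeriods.KontsevichZagierPeriods.Theorems
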